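import Literature.MathematicalPhysics.QuantumFieldTheory.Balaban1983to89.B1Eq324BenfattoAppendixDClustering
import HarnessLib

/-!
# `Balaban1983to89.B1Eq324BenfattoAppendixDTreeDecay` — [BenfattoEtAl1978] Appendix D pp. 165–166: the exponential clustering of
# connected diagrams with SPANNING-TREE decay (the legs' tree length in place of one pair distance), PROVED — what the free-side
# re-summation of §5 p. 159 («Collecting all the errors made in this process») needs for colourings spread over several boxes

statement-level skeleton of published theorems with citation tags; proofs where landed; nothing here is a claim about the
Yang–Mills mass gap

WHY THIS MODULE (cell `pub-ymgap`, seat `dag-n08-b`, node N08 «first missing estimate» lane; sequel of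
`B1Eq324BenfattoAppendixDClustering`).  Appendix D bounds a joint truncated expectation of monomial clusters under the (conditioned)
free field by the sum over CONNECTED Wick diagrams, and `…AppendixDClustering.abs_ursellOf_dmoment_le_exp` turns connectedness into
the decay `exp(−(δ/2)(ρ(u,w₀) − intra))` along ONE designated pair of legs `u, w₀` — exactly what (5.29) needs inside one box
(a leg of `Ψ″₁` in `□′∖Γ₄(□)`, a leg of `Ψ₂` in `Γ₂(□)`; p. 166).  The final step of §5, p. 159, re-sums the per-box free cumulants
`Σ_□ Σ_{k₁>0} Ê₀^T(Ψ″₁, Ψ′₁; k₁, k₂)` of the `d+1` pavements into `Σ_k Ê₀^T(H_J; k)/k!` (`…Sect5FreeCumulants`,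
`cumulantOf_telescope_eq_sum_local_add_cross`): the CROSS colourings there carry pieces of up to `k` DIFFERENT boxes (print's
application has `t = 3`, Remark 2 p. 152), and their sum over the boxes is extensive (`O(|I|)`, not `O(|I|^{k−1})`) only if the
diagram bound decays in the SPANNING TREE of all the legs, so that each far box costs its own exponential factor.  A connected
diagram connects ALL legs, so the same engine gives that stronger bound for free: the connecting edge set of
`B1Eq323ConnectedGraphBound.connects_of_isConn` has total length at least the legs' tree length `B3Ineq213.treeLen ρ`
(`B3Ineq213.treeLen_le_of_connects`), whence `|(dmoment)ᵀ| ≤ 2^{|Λ|}2^{2^{|Λ|}}K₀^{|Λ|}·exp(−(δ/2)(treeLen_Λ ρ − intra))`.  §3 pushes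
the tree length down to any coarser vertex set (clusters, boxes) along a labelling of the legs — the form in which the boxes
line's anchored lattice sums (`…Sect5Eq511.sum_exp_quarter_le`, `…Sect5Eq524.sum_exp_anchored_le`) are applied.

THE PRINTED TEXT (p. 166, verbatim from the page image `bcg_p166_s3.png`): *"ii) 𝓔^T_0(z^{A₁}, z^{A₂}, z^{A₃}; 1, 1, 1) is by definition an
algebraic sum of products of expectations values. As it is well known, once these expectations are expressed via the Wick theorem as
sum of products of 2-point functions, the only terms that survive are the so called "connected diagrams" where at least one z_Δ in
each set z^{A₁}, z^{A₂}, z^{A₃} is connected to another z_Δ belonging to a different set. If we recall now that at least one z_Δ in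
each term of Ψ̃″₁ belong to □′∖Γ₄(□) the exponential factors arising from i) and ii) give rise to an overall dumping factor that is
at least exp −(ϰ/4)b^{3/2} where b^{3/2}/2 is the length of the smallest path connecting a set of points constructed in such a way
that one point belongs by sure to □′/Γ₄(□) and at least another one belongs to Γ₂."*

DICTIONARY.  As in `…AppendixDClustering`: legs `Λ`, clusters `own : Λ → J`, block weights `w` (sources `≤ K₀`, propagators
`≤ K₀e^{−δρ}`, no higher blocks), pseudo-length `ρ` on the legs; «the length of the smallest path connecting a set of points» ↦
`B3Ineq213.treeLen ρ` (the minimum over connecting edge sets of the total `ρ`-length — [Balaban1983Higgs3] (1.33)'s tree length,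
in the tree since p19); «intra» ↦ `Σ_{(a,b) same cluster} ρ(a,b)`.

WHAT IS PROVED (theorems only; no definition, no named fact, no `sorry`; axioms standard).
* §1 **`treeLen_le_of_isConn`** — on a connected diagram `treeLen_Λ ρ ≤ Σ_{same cluster}ρ + Σ_B Σ_{a,b∈B} ρ(a,b)` (only `ρ ≥ 0` needed).
* §2 **`abs_sum_conn_dval_le_treeLen`**, ★★ **`abs_ursellOf_dmoment_le_exp_treeLen`** —
  `|(dmoment)ᵀ(all clusters)| ≤ 2^{|Λ|}·2^{2^{|Λ|}}·K₀^{|Λ|}·exp(−(δ/2)(treeLen_Λ ρ − Σ_{same cluster}ρ))`; the pair bound of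
  `…AppendixDClustering` follows since `ρ(u,w₀) ≤ treeLen ρ` (`B1Ineq358TreeLength.le_treeLen`).
* §3 **`treeLen_comap_le`** — COARSENING: for a labelling `φ : Λ → V` onto a finite vertex set and lengths `D` on `V` with
  `0 ≤ D(φ a, φ b) ≤ ρ(a, b)`, `treeLen_V D ≤ treeLen_Λ ρ` (a connecting edge set of the legs maps to a connecting edge set of the
  labels); ★ **`abs_ursellOf_dmoment_le_exp_treeLen_comap`** — the clustering bound with the decay in the tree length of ANY
  coarser labelling of the legs (clusters, tesserae, boxes).

HONEST SCOPE / NOT HERE.  Pure finite combinatorics + real inequalities (no measure), exactly as the parent.  NOT here: the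
measure half (Wick with a source: `…AppendixDWick`), the slot / polynomial / tuple-class lifts (`…Sect5PolyClusters`,
`…Sect5TupleClusters` carry the PAIR version; their tree-decay twins are the next adapters), the lattice sums over box positions.
Print's App. D states the pair decay only (one box); the tree decay is the standard strengthening its §5 re-summation silently
uses.  `BasicLemmaPrinted` stays OPEN.  NOT summit progress; count-neutral for N08; nothing of [Balaban1985UV3] is asserted.
-/

open Finset
open scoped BigOperators

namespace Literature.MathematicalPhysics.QuantumFieldTheory.Balaban1983to89.B1Eq324BenfattoAppendixDTreeDecay

open Literature.Probability.LatticeModels (IsSetPartition setPartitions mem_setPartitions ursellOf)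
open Literature.Probability.LatticeModels.LegDiagram (legs mem_legs diags mem_diags IsDiag Sep IsConn dval dmoment
  ursellOf_dmoment)
open Literature.MathematicalPhysics.QuantumFieldTheory.Balaban1983to89.B3Ineq213 (Connects treeLen treeLen_le_of_connects
  treeLen_nonneg)
open Literature.MathematicalPhysics.QuantumFieldTheory.Balaban1983to89.B1Eq323ConnectedGraphBound
  (allV some_mem_allV none_not_mem_allV edgeSet mem_edgeSet connects_of_isConn isSetPartition_of_mem_diags
   fst_eq_empty_of_mem_diags card_le_of_isSetPartition card_diags_le)
open Literature.MathematicalPhysics.QuantumFieldTheory.Balaban1983to89.B1Eq324BenfattoAppendixDClustering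
  (sum_blockPairs_le abs_dval_le)

variable {J : Type} [Fintype J] [DecidableEq J] {Λ : Type} [Fintype Λ] [DecidableEq Λ] (own : Λ → J)
variable (ρ : Λ → Λ → ℝ)

/-! ## §1  A connected diagram connects all the legs: its length dominates the legs' tree length -/

section Geometry

/-- **THE TREE LENGTH OF THE LEGS IS CONTROLLED BY THE INTRA-CLUSTER PAIRS AND THE BLOCKS**: for non-negative lengths `ρ` and a
connected diagram `g` on all the clusters, `treeLen_Λ ρ ≤ Σ_{(a,b) same cluster} ρ(a,b) + Σ_{B∈g} Σ_{a,b∈B} ρ(a,b)` — the blocks and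
the intra-cluster pairs form a connecting edge set (`B1Eq323ConnectedGraphBound.connects_of_isConn`), and the tree length is at most
the length of any connecting edge set (`B3Ineq213.treeLen_le_of_connects`). [cite: BenfattoEtAl1978, Appendix D p.166] -/
theorem treeLen_le_of_isConn (hnn : ∀ a b, 0 ≤ ρ a b) {g : Finset Λ × Finset (Finset Λ)} (hg : g ∈ diags own (allV J))
    (hc : IsConn own (allV J) g) :
    treeLen ρ ≤ (∑ p ∈ univ.filter (fun p : Λ × Λ => own p.1 = own p.2), ρ p.1 p.2)
        + ∑ B ∈ g.2, ∑ a ∈ B, ∑ b ∈ B, ρ a b := by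
  have h1 := treeLen_le_of_connects ρ (connects_of_isConn own hg hc)
  set S₁ := univ.filter (fun p : Λ × Λ => own p.1 = own p.2) with hS₁
  set S₂ := univ.filter (fun p : Λ × Λ => ∃ B ∈ g.2, p.1 ∈ B ∧ p.2 ∈ B) with hS₂
  set f : Λ × Λ → ℝ := fun p => ρ p.1 p.2 with hf
  have hu : ∑ e ∈ S₁ ∪ S₂, f e ≤ ∑ e ∈ S₁, f e + ∑ e ∈ S₂, f e := by
    rw [← sum_union_inter]
    exact le_add_of_nonneg_right (sum_nonneg fun p _ => hnn p.1 p.2)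
  have hS : edgeSet own g = S₁ ∪ S₂ := by
    rw [edgeSet, filter_or]
  rw [hS] at h1
  exact h1.trans (hu.trans (add_le_add le_rfl (sum_blockPairs_le ρ hnn (isSetPartition_of_mem_diags own hg))))

end Geometry

/-! ## §2  Exponential clustering with spanning-tree decay -/

section Clustering

variable (w : Finset Λ → ℝ) (ω : Finset Λ → ℝ) {K₀ δ : ℝ}

/-- **THE CONNECTED-DIAGRAM SUM DECAYS IN THE LEGS' TREE LENGTH**: under the hypotheses of `…AppendixDClustering.abs_dval_le`
(sources `≤ K₀`, propagators `≤ K₀e^{−δρ}`, no higher blocks, `K₀ ≥ 1`, `δ ≥ 0`) and `ρ ≥ 0` with zero diagonal and symmetric,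
`|Σ_{g connected} dval g| ≤ #diags·K₀^{|Λ|}·exp(−(δ/2)(treeLen_Λ ρ − Σ_{same cluster}ρ))`. [cite: BenfattoEtAl1978, Appendix D p.166] -/
theorem abs_sum_conn_dval_le_treeLen (h0 : ∀ a, ρ a a = 0) (hsymm : ∀ a b, ρ a b = ρ b a) (hnn : ∀ a b, 0 ≤ ρ a b)
    (hK₀ : 1 ≤ K₀) (hδ : 0 ≤ δ)
    (hw1 : ∀ l, |w {l}| ≤ K₀) (hw2 : ∀ a b, a ≠ b → |w {a, b}| ≤ K₀ * Real.exp (-(δ * ρ a b)))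
    (hw3 : ∀ B : Finset Λ, 3 ≤ B.card → w B = 0) :
    |∑ g ∈ (diags own (allV J)).filter (IsConn own (allV J)), dval w ω (allV J) g| ≤
      ((diags own (allV J)).card : ℝ) * (K₀ ^ Fintype.card Λ *
        Real.exp (-(δ / 2 * (treeLen ρ - ∑ p ∈ univ.filter (fun p : Λ × Λ => own p.1 = own p.2), ρ p.1 p.2)))) := by
  set intra := ∑ p ∈ univ.filter (fun p : Λ × Λ => own p.1 = own p.2), ρ p.1 p.2 with hintra
  have hterm : ∀ g ∈ (diags own (allV J)).filter (IsConn own (allV J)),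
      |dval w ω (allV J) g| ≤ K₀ ^ Fintype.card Λ * Real.exp (-(δ / 2 * (treeLen ρ - intra))) := by
    intro g hg
    obtain ⟨hgd, hgc⟩ := mem_filter.1 hg
    refine (abs_dval_le own ρ w ω h0 hsymm hK₀ hw1 hw2 hw3 hgd).trans ?_
    refine mul_le_mul_of_nonneg_left (Real.exp_le_exp.2 ?_) (pow_nonneg (zero_le_one.trans hK₀) _)
    have hd := treeLen_le_of_isConn own ρ hnn hgd hgc
    have : treeLen ρ - intra ≤ ∑ B ∈ g.2, ∑ a ∈ B, ∑ b ∈ B, ρ a b := by linarith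
    nlinarith
  refine (abs_sum_le_sum_abs _ _).trans ((sum_le_sum hterm).trans ?_)
  rw [sum_const, nsmul_eq_mul]
  exact mul_le_mul_of_nonneg_right (by exact_mod_cast card_filter_le _ _)
    (mul_nonneg (pow_nonneg (zero_le_one.trans hK₀) _) (Real.exp_pos _).le)

/-- **APPENDIX D WITH SPANNING-TREE DECAY**: the truncated function of the diagram moments of all the clusters (the sum over the
CONNECTED diagrams, `LatticeModels.LegDiagram.ursellOf_dmoment`) satisfies
`|(dmoment)ᵀ(all clusters)| ≤ 2^{|Λ|}·2^{2^{|Λ|}}·K₀^{|Λ|}·exp(−(δ/2)(treeLen_Λ ρ − Σ_{(a,b) same cluster} ρ(a,b)))` — «the length of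
the smallest path connecting a set of points» for the WHOLE set of legs; `…AppendixDClustering.abs_ursellOf_dmoment_le_exp` (one pair
`u, w₀`) is the special case `ρ(u,w₀) ≤ treeLen ρ`. [cite: BenfattoEtAl1978, Appendix D p.166] -/
theorem abs_ursellOf_dmoment_le_exp_treeLen [Nonempty J] (h0 : ∀ a, ρ a a = 0) (hsymm : ∀ a b, ρ a b = ρ b a)
    (hnn : ∀ a b, 0 ≤ ρ a b) (hK₀ : 1 ≤ K₀) (hδ : 0 ≤ δ)
    (hw1 : ∀ l, |w {l}| ≤ K₀) (hw2 : ∀ a b, a ≠ b → |w {a, b}| ≤ K₀ * Real.exp (-(δ * ρ a b)))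
    (hw3 : ∀ B : Finset Λ, 3 ≤ B.card → w B = 0) :
    |ursellOf (dmoment own w ω) (allV J)| ≤
      2 ^ Fintype.card Λ * 2 ^ 2 ^ Fintype.card Λ * (K₀ ^ Fintype.card Λ *
        Real.exp (-(δ / 2 * (treeLen ρ - ∑ p ∈ univ.filter (fun p : Λ × Λ => own p.1 = own p.2), ρ p.1 p.2)))) := by
  have hV : (allV J).Nonempty := by
    obtain ⟨j⟩ := ‹Nonempty J›
    exact ⟨some j, some_mem_allV j⟩
  rw [ursellOf_dmoment (own := own) w ω hV]
  refine (abs_sum_conn_dval_le_treeLen own ρ w ω h0 hsymm hnn hK₀ hδ hw1 hw2 hw3).trans ?_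
  exact mul_le_mul_of_nonneg_right (card_diags_le own)
    (mul_nonneg (pow_nonneg (zero_le_one.trans hK₀) _) (Real.exp_pos _).le)

end Clustering

/-! ## §3  Coarsening the tree length along a labelling of the legs (clusters, tesserae, boxes) -/

section Coarsen

variable {V : Type*} [Fintype V]

omit [Fintype J] [DecidableEq J] [Fintype Λ] [DecidableEq Λ] [Fintype V] in
/-- A connecting edge set of the legs maps to a connecting edge set of the labels under a surjective labelling. [folklore] -/
private theorem connects_image [DecidableEq V] (φ : Λ → V) (hφ : Function.Surjective φ) {S : Finset (Λ × Λ)}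
    (hS : Connects S) : Connects (S.image fun e => (φ e.1, φ e.2)) := by
  intro x y
  obtain ⟨a, rfl⟩ := hφ x
  obtain ⟨b, rfl⟩ := hφ y
  have key : ∀ a b : Λ, Relation.EqvGen (fun p q => (p, q) ∈ S) a b →
      Relation.EqvGen (fun p q => (p, q) ∈ S.image fun e => (φ e.1, φ e.2)) (φ a) (φ b) := by
    intro a b h
    induction h with
    | rel p q hpq => exact Relation.EqvGen.rel _ _ (mem_image.2 ⟨(p, q), hpq, rfl⟩)
    | refl p => exact Relation.EqvGen.refl _
    | symm p q _ ih => exact Relation.EqvGen.symm _ _ ih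
    | trans p q r _ _ ih1 ih2 => exact Relation.EqvGen.trans _ _ _ ih1 ih2
  exact key a b (hS a b)

omit [Fintype J] [DecidableEq J] [DecidableEq Λ] in
/-- **COARSENING THE TREE LENGTH**: for a surjective labelling `φ : Λ → V` of the legs and lengths `D` on the labels with
`0 ≤ D(φ a, φ b) ≤ ρ(a, b)`, `treeLen_V D ≤ treeLen_Λ ρ` — a shortest connecting graph of the legs, read through `φ`, connects the
labels and is no shorter in `D`.  (Labels = clusters: the tree length of the slots; labels = tesserae or boxes: the currency of the
boxes line's lattice sums.) [cite: BenfattoEtAl1978, Appendix D p.166] -/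
theorem treeLen_comap_le [DecidableEq V] (φ : Λ → V) (hφ : Function.Surjective φ) (D : V → V → ℝ)
    (hD : ∀ x y, 0 ≤ D x y) (hDρ : ∀ a b, D (φ a) (φ b) ≤ ρ a b) : treeLen D ≤ treeLen ρ := by
  classical
  -- `treeLen ρ` is attained on some connecting edge set `S`
  obtain ⟨S, hS, hSeq⟩ := Finset.exists_mem_eq_inf' (B3Ineq213.connSets_nonempty (V := Λ))
    (fun T : Finset (Λ × Λ) => ∑ e ∈ T, ρ e.1 e.2)
  have hSc : Connects S := B3Ineq213.mem_connSets.1 hS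
  have hρeq : treeLen ρ = ∑ e ∈ S, ρ e.1 e.2 := hSeq
  rw [hρeq]
  refine (treeLen_le_of_connects D (connects_image φ hφ hSc)).trans ?_
  calc ∑ e ∈ S.image (fun e => (φ e.1, φ e.2)), D e.1 e.2
      ≤ ∑ e ∈ S, D (φ e.1) (φ e.2) := Finset.sum_image_le_of_nonneg fun e _ => hD _ _
    _ ≤ ∑ e ∈ S, ρ e.1 e.2 := Finset.sum_le_sum fun e _ => hDρ e.1 e.2

/-- **APPENDIX D WITH THE DECAY IN THE TREE LENGTH OF ANY COARSER LABELLING**: under the hypotheses of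
`abs_ursellOf_dmoment_le_exp_treeLen`, for a surjective labelling `φ` of the legs and label lengths `0 ≤ D(φ a, φ b) ≤ ρ(a, b)`,
`|(dmoment)ᵀ(all clusters)| ≤ 2^{|Λ|}·2^{2^{|Λ|}}·K₀^{|Λ|}·exp(−(δ/2)(treeLen_V D − Σ_{same cluster}ρ))`.
[cite: BenfattoEtAl1978, Appendix D p.166] -/
theorem abs_ursellOf_dmoment_le_exp_treeLen_comap [Nonempty J] [DecidableEq V] (w : Finset Λ → ℝ) (ω : Finset Λ → ℝ)
    {K₀ δ : ℝ} (h0 : ∀ a, ρ a a = 0) (hsymm : ∀ a b, ρ a b = ρ b a) (hnn : ∀ a b, 0 ≤ ρ a b) (hK₀ : 1 ≤ K₀) (hδ : 0 ≤ δ)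
    (hw1 : ∀ l, |w {l}| ≤ K₀) (hw2 : ∀ a b, a ≠ b → |w {a, b}| ≤ K₀ * Real.exp (-(δ * ρ a b)))
    (hw3 : ∀ B : Finset Λ, 3 ≤ B.card → w B = 0)
    (φ : Λ → V) (hφ : Function.Surjective φ) (D : V → V → ℝ) (hD : ∀ x y, 0 ≤ D x y) (hDρ : ∀ a b, D (φ a) (φ b) ≤ ρ a b) :
    |ursellOf (dmoment own w ω) (allV J)| ≤
      2 ^ Fintype.card Λ * 2 ^ 2 ^ Fintype.card Λ * (K₀ ^ Fintype.card Λ *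
        Real.exp (-(δ / 2 * (treeLen D - ∑ p ∈ univ.filter (fun p : Λ × Λ => own p.1 = own p.2), ρ p.1 p.2)))) := by
  refine (abs_ursellOf_dmoment_le_exp_treeLen own ρ w ω h0 hsymm hnn hK₀ hδ hw1 hw2 hw3).trans ?_
  have hK : 0 ≤ K₀ ^ Fintype.card Λ := pow_nonneg (zero_le_one.trans hK₀) _
  refine mul_le_mul_of_nonneg_left (mul_le_mul_of_nonneg_left (Real.exp_le_exp.2 ?_) hK) (by positivity)
  have h := treeLen_comap_le ρ φ hφ D hD hDρ
  nlinarith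

end Coarsen

end Literature.MathematicalPhysics.QuantumFieldTheory.Balaban1983to89.B1Eq324BenfattoAppendixDTreeDecay
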